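import Summits.NavierStokesRegularity.NavierStokesRegularity.Theorems.LerayQuarterDissipationFiniteDissipationLiouvilleTraceApex
import Summits.NavierStokesRegularity.NavierStokesRegularity.Theorems.LerayQuarterDissipationFiniteDissipationLiouvilleTraceMorrey
import HarnessLib

/-!
# Crux `FiniteDissipationLiouville` (stmt-NavierStokesRegularity-22144): THE FAR FIELD OF THE
# FINAL DATUM CONTROLS THE APEX — a member of the stratum whose trace has trivial blow-DOWNS
# (e.g. lies in `L³` near spatial infinity) is regular at the apex

Theorems file of route `LerayQuarterDissipation` (lead prover g5; `--supports` the crux: a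
far-field leaf bearing on BOTH registered stubs of the line `birth`, for EVERY member — past-DSS or
past-wandering). Navier–Stokes regularity is NOT proved by anything here; no summit is.

`𝒟_{C,K}`: Type-I ancient mild fields `u` (`IsTypeIAncientMild C u`) with the quarter-rate law;
`T_u(φ) = lim_{t→0⁻} ∫⟪u(t), φ⟫` the distributional trace at the singular time (lead g3).
`…TraceApex` (this lead) proved the apex leaf by zooming IN: the parabolic blow-ups
`u_λ = λu(λ²·, λ·)`, `λ → 0⁺`, of a singular member are singular members whose traces are the
blow-ups `λu₀(λ·)` of the final datum `u₀`, and a singular limit with zero trace is impossible.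
**The singular clause at the space-time origin is invariant under ALL dilations, so the same
argument runs with `λ → ∞` (zooming OUT):**

* `not_singular_of_trace_blowdown_small` — **THE BLOW-DOWN TRACE LEAF**: if the Navier–Stokes
  blow-downs `λ u₀(λ ·)`, `λ → ∞`, of the final datum tend to `0` in `𝒟'(ℝ³)`, the member is
  regular at the apex (persistence of the apex singularity along the blow-DOWN sequence
  `nsRescale λ_k u`, `λ_k → ∞`; KNSS compactness; trace continuity; the final-slice leaf).
* `tendsto_pairing_add` — trace values are additive in the test field.
* `not_singular_of_trace_L3_small_atInfinity` — **`L³` NEAR INFINITY SUFFICES**: if for every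
  `ε > 0` there is `R` with `|T_u(ψ)| ≤ ε ‖ψ‖_{L^{3/2}}` for all test fields `ψ` supported in
  `{|x| > R}` (the distributional form of "`u₀ ∈ L³({|x| > R₀})`", by absolute continuity; a
  fortiori `|u₀(x)| = o(|x|⁻¹)` or `u₀ ∈ L^p` near infinity with `p ≤ 3`), then `u` is regular at the
  apex. The blow-down `λ⁻² T_u(φ(λ⁻¹·))` is split by a fixed cutoff into a near part, `O(λ⁻²)` by
  the `L²_loc` (critical-Morrey) bound of the trace (`exists_trace_morrey_bound_of_mem`, lead g5),
  and a far part `≤ ε ‖φ‖_{L^{3/2}}` by the exact `L^{3/2}`-criticality of the dilation.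
* PORTRAIT (`trace_L3_concentration_atInfinity_of_singular`): **the final datum of every SINGULAR
  member of `𝒟` — DSS or wandering — has NON-VANISHING `L³`-MASS AT INFINITY: there is `ε₀ > 0`
  such that outside EVERY ball some test field has `|T_u(ψ)| > ε₀ ‖ψ‖_{L^{3/2}}`; in particular
  `u₀ ∉ L³({|x| > R})` for every `R`, and `u₀` is not `o(|x|⁻¹)` at infinity.** This sharpens the
  far-field trace leaf of `…TraceSupport` (unbounded support) to the critical decay: together with
  `…TraceApex`, the singular final datum is `L³`-nontrivial at BOTH ends of the dilation orbit,
  exactly like the homogeneous profiles `a(x̂)|x|⁻¹` of the DSS wall — now for the wandering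
  stratum too. Bookkeeping: `finiteDissipationLiouville_iff_L3atInfinity`.

References: Koch–Nadirashvili–Seregin–Šverák, Acta Math. 203 (2009), §4 (compactness);
Albritton–Barker, arXiv:1811.00502, Prop. 2.3 (persistence of singularities); Lemarié-Rieusset
(2016), Thm. 15.4.
-/

noncomputable section

-- the summit and its single sub-problem share the name (CONVENTIONS §1), as in every Theorems file
set_option linter.dupNamespace false

namespace Summit.NavierStokesRegularity.NavierStokesRegularity.Theorems.FiniteDissipationLiouville.Birth.Apex

open MeasureTheory Set Filter Topology Metric Function TopologicalSpace
open Literature.Analysis Literature.Analysis.FluidPDE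
open scoped ENNReal NNReal RealInnerProductSpace

variable {C K : ℝ} {u : ℝ → EuclideanSpace ℝ (Fin 3) → EuclideanSpace ℝ (Fin 3)}

/-! ### The blow-down trace leaf -/

/-- **THE BLOW-DOWN TRACE LEAF: a member of the stratum whose final datum has trivial blow-downs
at spatial infinity is regular at the apex.** Hypothesis (`hblow`): for every test field `φ` and
`ε > 0` there is `λ₀` such that for `λ > λ₀` the trace value `T` of `u` against `φ(λ⁻¹ ·)`
satisfies `|λ⁻² T| ≤ ε` — the Navier–Stokes blow-downs `λ u₀(λ ·)` of the trace tend to `0` in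
`𝒟'(ℝ³)` as `λ → ∞`. Conclusion: `u` is bounded on some backward cylinder at the origin. -/
theorem not_singular_of_trace_blowdown_small (hu : IsTypeIAncientMild C u)
    (hlaw : ∀ s : ℝ, s < 0 → ∫⁻ x, ‖fderiv ℝ (u s) x‖ₑ ^ 2 ≤ ENNReal.ofReal (K / Real.sqrt (-s)))
    (hblow : ∀ φ : EuclideanSpace ℝ (Fin 3) → EuclideanSpace ℝ (Fin 3),
      FunctionSpaces.IsTestFunctionOn (⊤ : Opens (EuclideanSpace ℝ (Fin 3))) φ →
      ∀ ε > 0, ∃ lam₀ : ℝ, ∀ lam : ℝ, lam₀ < lam →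
        ∀ T : ℝ, Tendsto (fun t => ∫ x, ⟪u t x, φ (lam⁻¹ • x)⟫) (𝓝[<] 0) (𝓝 T) →
          |(lam ^ 2)⁻¹ * T| ≤ ε) :
    ¬ (∀ r > 0, ∀ M : ℝ, ∃ t ∈ Set.Ioo (-(r ^ 2)) (0 : ℝ),
        ∃ x ∈ Metric.ball (0 : EuclideanSpace ℝ (Fin 3)) r, M < ‖u t x‖) := by
  intro hsing
  -- ### the blow-down sequence `u_k = nsRescale λ_k u`, `λ_k = k + 2 → ∞`
  set lam : ℕ → ℝ := fun k => (k : ℝ) + 2 with hlam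
  have hlam0 : ∀ k, 0 < lam k := fun k => by rw [hlam]; positivity
  have hlamt : Tendsto lam atTop atTop :=
    tendsto_atTop_add_const_right _ _ tendsto_natCast_atTop_atTop
  set w : ℕ → ℝ → EuclideanSpace ℝ (Fin 3) → EuclideanSpace ℝ (Fin 3) :=
    fun k => nsRescale (lam k) u with hw
  have hwk : ∀ k, IsTypeIAncientMild C (w k) := fun k => hu.nsRescale (hlam0 k)
  have hlawk : ∀ k, ∀ s : ℝ, s < 0 →
      ∫⁻ x, ‖fderiv ℝ (w k s) x‖ₑ ^ 2 ≤ ENNReal.ofReal (K / Real.sqrt (-s)) :=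
    fun k => RecurrentReductionD.dissipationLaw_nsRescale hlaw (hlam0 k)
  have hsingk : ∀ k, ∀ r > 0, ∀ M : ℝ, ∃ t ∈ Ioo (-(r ^ 2)) (0 : ℝ),
      ∃ x ∈ ball (0 : EuclideanSpace ℝ (Fin 3)) r, M < ‖w k t x‖ :=
    fun k => RecurrentReductionD.singularAtOrigin_nsRescale hsing (hlam0 k)
  -- ### KNSS compactness across members: a singular limit member `W ∈ 𝒟_{C,K}`
  obtain ⟨ψ, hψ, W, hW, hunif, hpt, hgrad⟩ := Compactness.seqLimit hwk
  have hψt : Tendsto ψ atTop atTop := hψ.tendsto_atTop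
  have hWlaw : ∀ s : ℝ, s < 0 →
      ∫⁻ x, ‖fderiv ℝ (W s) x‖ₑ ^ 2 ≤ ENNReal.ofReal (K / Real.sqrt (-s)) :=
    Compactness.law_of_seqLimit (Kinf := K) (Kk := fun _ => K) hψt hlawk
      (fun ε hε => Eventually.of_forall fun _ => by linarith) hgrad
  have hWsing := Compactness.persistent_singularity_seq (w := fun j => w (ψ j))
    (fun j => hwk (ψ j)) (fun j => hlawk (ψ j)) (fun j => hsingk (ψ j)) hW hunif
  -- ### the trace of `W` vanishes
  refine notSingular_of_tendsto_finalSlice hW hWlaw (fun φ hφ => ?_) hWsing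
  obtain ⟨L, hL⟩ := exists_tendsto_pairing_finalSlice hW hWlaw hφ
  suffices hL0 : L = 0 by rwa [hL0] at hL
  have hex : ∀ j, ∃ Tl : ℝ,
      Tendsto (fun t => ∫ x, ⟪u t x, φ ((lam (ψ j))⁻¹ • x)⟫) (𝓝[<] 0) (𝓝 Tl) := fun j =>
    exists_tendsto_pairing_finalSlice hu hlaw (hφ.comp_smul_top (inv_ne_zero (hlam0 (ψ j)).ne'))
  choose Tl hTl using hex
  have hLw : ∀ j, Tendsto (fun t => ∫ x, ⟪w (ψ j) t x, φ x⟫) (𝓝[<] 0)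
      (𝓝 ((lam (ψ j) ^ 2)⁻¹ * Tl j)) := fun j =>
    tendsto_pairing_nsRescale (hlam0 (ψ j)) (hTl j)
  have hconv : Tendsto (fun j => (lam (ψ j) ^ 2)⁻¹ * Tl j) atTop (𝓝 L) :=
    tendsto_trace_of_tendsto_slices hφ (fun j => hwk (ψ j)) (fun j => hlawk (ψ j)) hW hWlaw
      (fun t ht x => hpt t ht x) hLw hL
  have hzero : Tendsto (fun j => (lam (ψ j) ^ 2)⁻¹ * Tl j) atTop (𝓝 0) := by
    rw [Metric.tendsto_atTop]
    intro ε hε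
    obtain ⟨lam₀, hsmall⟩ := hblow φ hφ (ε / 2) (half_pos hε)
    have hev : ∀ᶠ j in atTop, lam₀ < lam (ψ j) := (hlamt.comp hψt).eventually_gt_atTop lam₀
    obtain ⟨N, hN⟩ := eventually_atTop.1 hev
    refine ⟨N, fun j hj => ?_⟩
    rw [Real.dist_eq, sub_zero]
    exact (hsmall (lam (ψ j)) (hN j hj) (Tl j) (hTl j)).trans_lt (half_lt_self hε)
  exact tendsto_nhds_unique hconv hzero

/-! ### Additivity of trace values -/

/-- **Trace values are additive in the test field**: if `∫⟪u(t), ψ₁⟫ → T₁` and `∫⟪u(t), ψ₂⟫ → T₂`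
as `t → 0⁻`, then `∫⟪u(t), ψ₁ + ψ₂⟫ → T₁ + T₂`. -/
theorem tendsto_pairing_add (hu : IsTypeIAncientMild C u)
    {ψ₁ ψ₂ : EuclideanSpace ℝ (Fin 3) → EuclideanSpace ℝ (Fin 3)}
    (hψ₁ : FunctionSpaces.IsTestFunctionOn (⊤ : Opens (EuclideanSpace ℝ (Fin 3))) ψ₁)
    (hψ₂ : FunctionSpaces.IsTestFunctionOn (⊤ : Opens (EuclideanSpace ℝ (Fin 3))) ψ₂)
    {T₁ T₂ : ℝ} (h₁ : Tendsto (fun t => ∫ x, ⟪u t x, ψ₁ x⟫) (𝓝[<] 0) (𝓝 T₁))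
    (h₂ : Tendsto (fun t => ∫ x, ⟪u t x, ψ₂ x⟫) (𝓝[<] 0) (𝓝 T₂)) :
    Tendsto (fun t => ∫ x, ⟪u t x, ψ₁ x + ψ₂ x⟫) (𝓝[<] 0) (𝓝 (T₁ + T₂)) := by
  refine (h₁.add h₂).congr' ?_
  filter_upwards [self_mem_nhdsWithin] with t ht
  have ht0 : t < 0 := ht
  have i₁ : Integrable (fun x => ⟪u t x, ψ₁ x⟫) :=
    integrable_inner_of_continuous_of_hasCompactSupport (hu.continuous_slice ht0)
      hψ₁.contDiff.continuous hψ₁.hasCompactSupport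
  have i₂ : Integrable (fun x => ⟪u t x, ψ₂ x⟫) :=
    integrable_inner_of_continuous_of_hasCompactSupport (hu.continuous_slice ht0)
      hψ₂.contDiff.continuous hψ₂.hasCompactSupport
  rw [← integral_add i₁ i₂]
  refine integral_congr_ae (ae_of_all _ fun x => ?_)
  exact (inner_add_right _ _ _).symm

/-! ### Cutoffs of test fields -/

/-- **The near and far cutoffs of a test field are test fields.** For a smooth bump `χ` centred at
`0` and a test field `φ`: `χ • φ` is a test field supported in `B(0, r_out)`, `(1 − χ) • φ` is a
test field supported in `{|x| > r_in}`, and `‖(1 − χ)φ‖ ≤ ‖φ‖` pointwise. -/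
theorem isTestFunctionOn_cutoffs (χ : ContDiffBump (0 : EuclideanSpace ℝ (Fin 3)))
    {φ : EuclideanSpace ℝ (Fin 3) → EuclideanSpace ℝ (Fin 3)}
    (hφ : FunctionSpaces.IsTestFunctionOn (⊤ : Opens (EuclideanSpace ℝ (Fin 3))) φ) :
    FunctionSpaces.IsTestFunctionOn (⊤ : Opens (EuclideanSpace ℝ (Fin 3))) (fun x => χ x • φ x) ∧
      FunctionSpaces.IsTestFunctionOn (⊤ : Opens (EuclideanSpace ℝ (Fin 3)))
        (fun x => (1 - χ x) • φ x) ∧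
      (∀ x, χ x • φ x ≠ 0 → x ∈ ball (0 : EuclideanSpace ℝ (Fin 3)) χ.rOut) ∧
      (∀ x, (1 - χ x) • φ x ≠ 0 → χ.rIn < ‖x‖) ∧
      (∀ x, ‖(1 - χ x) • φ x‖ ≤ ‖φ x‖) := by
  have hcd : ContDiff ℝ (⊤ : ℕ∞) (fun x => 1 - χ x) := contDiff_const.sub χ.contDiff
  refine ⟨⟨χ.contDiff.smul hφ.contDiff,
      hφ.hasCompactSupport.mono fun x hx => right_ne_zero_of_smul hx, fun y _ => Opens.mem_top y⟩,
    ⟨hcd.smul hφ.contDiff, hφ.hasCompactSupport.mono fun x hx => right_ne_zero_of_smul hx,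
      fun y _ => Opens.mem_top y⟩, fun x hx => ?_, fun x hx => ?_, fun x => ?_⟩
  · have h : χ x ≠ 0 := left_ne_zero_of_smul hx
    have h2 : x ∈ Function.support χ := h
    rwa [χ.support_eq] at h2
  · by_contra hle
    push Not at hle
    have h1 : χ x = 1 := χ.one_of_mem_closedBall (by rwa [mem_closedBall, dist_zero_right])
    rw [h1, sub_self, zero_smul] at hx
    exact hx rfl
  · rw [norm_smul, Real.norm_eq_abs, abs_of_nonneg (sub_nonneg.2 χ.le_one)]
    calc (1 - χ x) * ‖φ x‖ ≤ 1 * ‖φ x‖ :=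
          mul_le_mul_of_nonneg_right (sub_le_self _ (χ.nonneg)) (norm_nonneg _)
      _ = ‖φ x‖ := one_mul _

/-! ### `L³` near infinity suffices -/

/-- **`L³`-SMALLNESS OF THE FINAL DATUM AT INFINITY FORCES REGULARITY AT THE APEX.** If for every
`ε > 0` there is `R` such that `|T_u(ψ)| ≤ ε ‖ψ‖_{L^{3/2}}` for all test fields `ψ` supported in
`{|x| > R}` (e.g. `u₀ ∈ L³({|x| > R₀})`), then `u` is NOT singular at the apex — for every member
of the stratum. Proof: the blow-down `λ⁻² T_u(φ(λ⁻¹·))` splits by a fixed cutoff `χ`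
(`= 1` on `B̄(0, R+1)`, supported in `B(0, R+2)`): the near part is `O(λ⁻²)` by the `L²_loc`
bound of the trace (`exists_trace_morrey_bound_of_mem`), the far part is `≤ ε λ² ‖φ‖_{L^{3/2}}`
by the `L^{3/2}`-criticality of the dilation; then `not_singular_of_trace_blowdown_small`. -/
theorem not_singular_of_trace_L3_small_atInfinity (hu : IsTypeIAncientMild C u)
    (hlaw : ∀ s : ℝ, s < 0 → ∫⁻ x, ‖fderiv ℝ (u s) x‖ₑ ^ 2 ≤ ENNReal.ofReal (K / Real.sqrt (-s)))
    (hfar : ∀ ε > 0, ∃ R > 0, ∀ ψ : EuclideanSpace ℝ (Fin 3) → EuclideanSpace ℝ (Fin 3),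
      FunctionSpaces.IsTestFunctionOn (⊤ : Opens (EuclideanSpace ℝ (Fin 3))) ψ →
      (∀ x, ψ x ≠ 0 → R < ‖x‖) →
      ∀ T : ℝ, Tendsto (fun t => ∫ x, ⟪u t x, ψ x⟫) (𝓝[<] 0) (𝓝 T) →
        |T| ≤ ε * (∫ x, ‖ψ x‖ ^ (3 / 2 : ℝ)) ^ (2 / 3 : ℝ)) :
    ¬ (∀ r > 0, ∀ M' : ℝ, ∃ t ∈ Set.Ioo (-(r ^ 2)) (0 : ℝ),
        ∃ x ∈ Metric.ball (0 : EuclideanSpace ℝ (Fin 3)) r, M' < ‖u t x‖) := by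
  obtain ⟨M, hM0, hM⟩ := exists_trace_morrey_bound_of_mem hu hlaw
  refine not_singular_of_trace_blowdown_small hu hlaw fun φ hφ ε hε => ?_
  -- ### data of `φ`: sup bound `K₀`, the `L^{3/2}` mass `I`
  obtain ⟨K₀, hK₀⟩ := hφ.contDiff.continuous.bounded_above_of_compact_support hφ.hasCompactSupport
  have hK₀0 : 0 ≤ K₀ := (norm_nonneg _).trans (hK₀ 0)
  set I : ℝ := ∫ x, ‖φ x‖ ^ (3 / 2 : ℝ) with hI
  have hI0 : 0 ≤ I := integral_nonneg fun _ => Real.rpow_nonneg (norm_nonneg _) _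
  have hJ0 : 0 ≤ I ^ (2 / 3 : ℝ) := Real.rpow_nonneg hI0 _
  -- ### the far radius `R` for `ε' = ε / (2 (I^{2/3} + 1))` and the cutoff `χ`
  obtain ⟨R, hR, hsmall⟩ := hfar (ε / (2 * (I ^ (2 / 3 : ℝ) + 1))) (by positivity)
  let χ : ContDiffBump (0 : EuclideanSpace ℝ (Fin 3)) := ⟨R + 1, R + 2, by linarith, by linarith⟩
  have hχin : χ.rIn = R + 1 := rfl
  have hχout : χ.rOut = R + 2 := rfl
  -- ### the near part is bounded independently of `λ`: `|T(χ φ_λ)| ≤ A`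
  set V : ℝ := (volume : Measure (EuclideanSpace ℝ (Fin 3))).real
    (ball (0 : EuclideanSpace ℝ (Fin 3)) (R + 2)) with hV
  set A : ℝ := M * Real.sqrt (R + 2) * Real.sqrt (K₀ ^ 2 * V) with hA
  have hA0 : 0 ≤ A := by positivity
  -- ### `λ₀`: beyond it `A/λ² ≤ ε/2`
  refine ⟨Real.sqrt (2 * A / ε) + 1, fun lam hlam T hT => ?_⟩
  have hsq : 0 ≤ Real.sqrt (2 * A / ε) := Real.sqrt_nonneg _
  have hlam0 : 0 < lam := by linarith
  have hlam2 : 0 < lam ^ 2 := by positivity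
  have hAlam : A ≤ ε / 2 * lam ^ 2 := by
    have h1 : 2 * A / ε ≤ lam ^ 2 := by
      calc 2 * A / ε = Real.sqrt (2 * A / ε) ^ 2 := (Real.sq_sqrt (by positivity)).symm
        _ ≤ lam ^ 2 := by
            apply pow_le_pow_left₀ hsq
            linarith
    have h2 := (div_le_iff₀ hε).1 h1
    linarith
  -- ### the dilated field and its two cutoffs
  set φl : EuclideanSpace ℝ (Fin 3) → EuclideanSpace ℝ (Fin 3) := fun x => φ (lam⁻¹ • x) with hφl
  have hφl : FunctionSpaces.IsTestFunctionOn (⊤ : Opens (EuclideanSpace ℝ (Fin 3))) φl :=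
    hφ.comp_smul_top (inv_ne_zero hlam0.ne')
  obtain ⟨hnear, hfarψ, hnear_supp, hfar_supp, hfar_le⟩ := isTestFunctionOn_cutoffs χ hφl
  obtain ⟨T₁, hT₁⟩ := exists_tendsto_pairing_finalSlice hu hlaw hnear
  obtain ⟨T₂, hT₂⟩ := exists_tendsto_pairing_finalSlice hu hlaw hfarψ
  -- `T = T₁ + T₂`
  have hsum : Tendsto (fun t => ∫ x, ⟪u t x, φl x⟫) (𝓝[<] 0) (𝓝 (T₁ + T₂)) := by
    have h := tendsto_pairing_add hu hnear hfarψ hT₁ hT₂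
    refine h.congr fun t => ?_
    refine integral_congr_ae (ae_of_all _ fun x => ?_)
    show ⟪u t x, χ x • φl x + (1 - χ x) • φl x⟫ = ⟪u t x, φl x⟫
    rw [← add_smul, add_sub_cancel, one_smul]
  have hTeq : T = T₁ + T₂ := tendsto_nhds_unique hT hsum
  -- ### the near part: `|T₁| ≤ A`
  have hT₁b : |T₁| ≤ A := by
    have h := hM 0 (R + 2) (by linarith) _ hnear hnear_supp T₁ hT₁
    refine h.trans ?_
    rw [hA]
    refine mul_le_mul_of_nonneg_left (Real.sqrt_le_sqrt ?_) (by positivity)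
    -- `∫ ‖χ φ_λ‖² ≤ K₀² · vol B(0, R+2)`
    have hzero : ∀ x, x ∉ ball (0 : EuclideanSpace ℝ (Fin 3)) (R + 2) → ‖χ x • φl x‖ ^ 2 = 0 := by
      intro x hx
      have h0 : χ x • φl x = 0 := by
        by_contra hne
        exact hx (hnear_supp x hne)
      rw [h0, norm_zero, zero_pow two_ne_zero]
    rw [← setIntegral_eq_integral_of_forall_compl_eq_zero hzero]
    have hbound : ∀ x ∈ ball (0 : EuclideanSpace ℝ (Fin 3)) (R + 2), ‖‖χ x • φl x‖ ^ 2‖ ≤ K₀ ^ 2 := by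
      intro x _
      rw [Real.norm_eq_abs, abs_of_nonneg (sq_nonneg _), norm_smul, Real.norm_eq_abs,
        abs_of_nonneg (χ.nonneg)]
      have h1 : χ x * ‖φl x‖ ≤ 1 * K₀ :=
        mul_le_mul χ.le_one (hK₀ _) (norm_nonneg _) zero_le_one
      rw [one_mul] at h1
      have h2 : 0 ≤ χ x * ‖φl x‖ := mul_nonneg χ.nonneg (norm_nonneg _)
      nlinarith
    have hfin : volume (ball (0 : EuclideanSpace ℝ (Fin 3)) (R + 2)) < ∞ := measure_ball_lt_top
    have h := norm_setIntegral_le_of_norm_le_const hfin hbound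
    rw [Real.norm_eq_abs] at h
    exact (le_abs_self _).trans h
  -- ### the far part: `|T₂| ≤ ε' λ² I^{2/3}`
  have hT₂b : |T₂| ≤ ε / (2 * (I ^ (2 / 3 : ℝ) + 1)) * (lam ^ 2 * I ^ (2 / 3 : ℝ)) := by
    have hsupp2 : ∀ x, (1 - χ x) • φl x ≠ 0 → R < ‖x‖ := fun x hx => by
      have h := hfar_supp x hx
      rw [hχin] at h
      linarith
    have h := hsmall _ hfarψ hsupp2 T₂ hT₂
    refine h.trans (mul_le_mul_of_nonneg_left ?_ (by positivity))
    -- `‖(1-χ)φ_λ‖_{3/2} ≤ ‖φ_λ‖_{3/2} = (λ³ I)^{2/3} = λ² I^{2/3}`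
    have hmono : ∫ x, ‖(1 - χ x) • φl x‖ ^ (3 / 2 : ℝ) ≤ ∫ x, ‖φl x‖ ^ (3 / 2 : ℝ) := by
      refine integral_mono_of_nonneg (ae_of_all _ fun x => Real.rpow_nonneg (norm_nonneg _) _)
        ?_ (ae_of_all _ fun x => Real.rpow_le_rpow (norm_nonneg _) (hfar_le x) (by norm_num))
      exact ((hφl.contDiff.continuous.norm.rpow_const fun _ => Or.inr (by norm_num))
        ).integrable_of_hasCompactSupport
        ((hφl.hasCompactSupport.norm.rpow_const (by norm_num)))
    have hscale : ∫ x, ‖φl x‖ ^ (3 / 2 : ℝ) = lam ^ 3 * I :=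
      integral_comp_inv_smul_eq (g := fun x => ‖φ x‖ ^ (3 / 2 : ℝ)) hlam0
    have hpow : (lam ^ 3 * I) ^ (2 / 3 : ℝ) = lam ^ 2 * I ^ (2 / 3 : ℝ) := by
      rw [Real.mul_rpow (pow_nonneg hlam0.le 3) hI0]
      congr 1
      rw [← Real.rpow_natCast lam 3, ← Real.rpow_mul hlam0.le]
      norm_num
    calc (∫ x, ‖(1 - χ x) • φl x‖ ^ (3 / 2 : ℝ)) ^ (2 / 3 : ℝ)
        ≤ (∫ x, ‖φl x‖ ^ (3 / 2 : ℝ)) ^ (2 / 3 : ℝ) :=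
          Real.rpow_le_rpow (integral_nonneg fun _ => Real.rpow_nonneg (norm_nonneg _) _) hmono
            (by norm_num)
      _ = lam ^ 2 * I ^ (2 / 3 : ℝ) := by rw [hscale, hpow]
  -- ### assembly: `|λ⁻² T| ≤ A/λ² + ε' I^{2/3} ≤ ε`
  have hfrac : ε / (2 * (I ^ (2 / 3 : ℝ) + 1)) * I ^ (2 / 3 : ℝ) ≤ ε / 2 := by
    rw [div_mul_eq_mul_div, div_le_div_iff₀ (by positivity) (by norm_num)]
    nlinarith
  calc |(lam ^ 2)⁻¹ * T| = (lam ^ 2)⁻¹ * |T₁ + T₂| := by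
        rw [abs_mul, abs_of_pos (inv_pos.2 hlam2), hTeq]
    _ ≤ (lam ^ 2)⁻¹ * (|T₁| + |T₂|) :=
        mul_le_mul_of_nonneg_left (abs_add_le _ _) (inv_nonneg.2 hlam2.le)
    _ ≤ (lam ^ 2)⁻¹ * (ε / 2 * lam ^ 2 +
          ε / (2 * (I ^ (2 / 3 : ℝ) + 1)) * (lam ^ 2 * I ^ (2 / 3 : ℝ))) :=
        mul_le_mul_of_nonneg_left (add_le_add (hT₁b.trans hAlam) hT₂b) (inv_nonneg.2 hlam2.le)
    _ = ε / 2 + ε / (2 * (I ^ (2 / 3 : ℝ) + 1)) * I ^ (2 / 3 : ℝ) := by field_simp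
    _ ≤ ε := by linarith

/-! ### Portrait: the final datum of a singular member is `L³`-nontrivial at infinity -/

/-- **PORTRAIT ENTRY (both stubs): the final datum of a SINGULAR member of the stratum — DSS or
wandering — has NON-VANISHING `L³`-MASS NEAR INFINITY**: there is `ε₀ > 0` such that outside
EVERY ball `B(0, R)` some test field `ψ` has a trace value with `|T| > ε₀ ‖ψ‖_{L^{3/2}}`. In
particular `u₀ ∉ L³({|x| > R})` for every `R`, and `u₀` is not `o(|x|⁻¹)` at infinity (the DSS
profiles `a(x̂)|x|⁻¹` saturate this). -/
theorem trace_L3_concentration_atInfinity_of_singular (hu : IsTypeIAncientMild C u)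
    (hlaw : ∀ s : ℝ, s < 0 → ∫⁻ x, ‖fderiv ℝ (u s) x‖ₑ ^ 2 ≤ ENNReal.ofReal (K / Real.sqrt (-s)))
    (hsing : ∀ r > 0, ∀ M' : ℝ, ∃ t ∈ Set.Ioo (-(r ^ 2)) (0 : ℝ),
      ∃ x ∈ Metric.ball (0 : EuclideanSpace ℝ (Fin 3)) r, M' < ‖u t x‖) :
    ∃ ε > 0, ∀ R > 0, ∃ (ψ : EuclideanSpace ℝ (Fin 3) → EuclideanSpace ℝ (Fin 3)) (T : ℝ),
      FunctionSpaces.IsTestFunctionOn (⊤ : Opens (EuclideanSpace ℝ (Fin 3))) ψ ∧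
        (∀ x, ψ x ≠ 0 → R < ‖x‖) ∧
        Tendsto (fun t => ∫ x, ⟪u t x, ψ x⟫) (𝓝[<] 0) (𝓝 T) ∧
        ε * (∫ x, ‖ψ x‖ ^ (3 / 2 : ℝ)) ^ (2 / 3 : ℝ) < |T| := by
  by_contra h
  push Not at h
  refine not_singular_of_trace_L3_small_atInfinity hu hlaw (fun ε hε => ?_) hsing
  obtain ⟨R, hR, hh⟩ := h ε hε
  exact ⟨R, hR, fun ψ hψ hs T hT => hh ψ T hψ hs hT⟩

/-! ### Bookkeeping: the crux lives on members whose trace is `L³`-nontrivial at infinity -/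

/-- **The crux is equivalent to its restriction to members whose final datum has non-vanishing
`L³`-mass near infinity** (members failing this are regular at the apex, by the blow-down trace
leaf). -/
theorem finiteDissipationLiouville_iff_L3atInfinity :
    Theses.LerayQuarterDissipation.FiniteDissipationLiouville ↔
      ∀ (C K : ℝ) (ū : ℝ → EuclideanSpace ℝ (Fin 3) → EuclideanSpace ℝ (Fin 3)),
        IsTypeIAncientMild C ū →
        (∀ s : ℝ, s < 0 → ∫⁻ x, ‖fderiv ℝ (ū s) x‖ₑ ^ 2 ≤ ENNReal.ofReal (K / Real.sqrt (-s))) →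
        (∃ ε > 0, ∀ R > 0, ∃ (ψ : EuclideanSpace ℝ (Fin 3) → EuclideanSpace ℝ (Fin 3)) (T : ℝ),
          FunctionSpaces.IsTestFunctionOn (⊤ : Opens (EuclideanSpace ℝ (Fin 3))) ψ ∧
            (∀ x, ψ x ≠ 0 → R < ‖x‖) ∧
            Tendsto (fun t => ∫ x, ⟪ū t x, ψ x⟫) (𝓝[<] 0) (𝓝 T) ∧
            ε * (∫ x, ‖ψ x‖ ^ (3 / 2 : ℝ)) ^ (2 / 3 : ℝ) < |T|) →
        ¬ (∀ r > 0, ∀ M : ℝ, ∃ t ∈ Set.Ioo (-(r ^ 2)) (0 : ℝ),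
            ∃ x ∈ Metric.ball (0 : EuclideanSpace ℝ (Fin 3)) r, M < ‖ū t x‖) := by
  constructor
  · intro h C K ū hū hD _
    exact h C K ū hū hD
  · intro h C K ū hū hD hsing
    exact h C K ū hū hD (trace_L3_concentration_atInfinity_of_singular hū hD hsing) hsing

end Summit.NavierStokesRegularity.NavierStokesRegularity.Theorems.FiniteDissipationLiouville.Birth.Apex

end
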